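import Summits.CriticalPhenomena.PercolationContinuityZ3.Theorems.PercNearOneGluingNoHeavyLowerTailQ44TopLabelCert
import HarnessLib

/-!
# The dart-free layer of R4: every pairing chain is packed (label certificates, all `n`)

Support file for crux `stmt-CriticalPhenomena-4575` (master-family programme; Conjecture W / packing `U` line), seat `prim-l12-p6` gen 32;
memo `run/shared/lean/prim/prim-l12/FROM-prim-l12-p6-g32-R4-PAIRING-LAYER.md`.  Cells as in `FourPointAtoms.pat4`
(`0 ⊥, 1 cy, 2 by, 3 bc, 4 ay, 5 ac, 6 ab, 7 bcy, 8 R = ay|bc, 9 Q = ac|by, 10 acy, 11 P = ab|cy, 12 aby, 13 abc, 14 ⊤`).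

Gen 31 (memo `…-g31-PRIMED-FAMILY.md` §12–13) computed the cone of B_4-achievable complementary antipodal type counts exactly: a row
`2·N(abcy;⊥) ≥ Σ_t w_t N_t` (27 complementary types) holds on every monotone map of `B_4` iff 31 linear constraints hold, and
conjecture R4 says the same 31 constraints decide validity for all `m`.  On the DART-FREE coordinates (the 3 pairing–pairing types
`(π;π′)` and the 12 pairing–pair types `(π;s)`, `s` a pair of another pairing) the constraint polytope is
`{w(π;π′) ≤ 2} × Π_{π≠π′} {stable-set polytope of a 4-cycle}`, so its vertices are `0/2`-valued: `e₂` of the pairings plus, for each of the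
three unordered pairs `{π, π′}`, ONE orientation "π charges the two pairs of π′".  The 8 orientations of the triangle `{P, Q, R}` split into
6 transitive ones (chains `π₁ > π₂ > π₃`) and 2 cyclic ones.

* `TwoCopyMono.chain_PQR_pack`, …, `chain_RQP_pack` — **all six chains are theorems for every finite weighted graph and all `n`**:
  `c0·c14 ≥ e₂(c8,c9,c11) + c_{π₁}(pairs of π₂ + pairs of π₃) + c_{π₂}(pairs of π₃)`, each by a nine-type label certificate with TOP goods
  (`packTop_of_tableOKT`, checked by `decide`).  `chain_RPQ_pack` strictly contains gen 31's `uPR_weightTwo_pack` (adds `c11·(c5 + c2)`); the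
  average of the six chains is the pair part `e₂ + ½·Σ₁₂ c_π c_s` of the row `V` (`…Q44RowV`), hence that pair part is a theorem too.
* `TwoCopyMono.chain_PQR_defect_packAC`, `chain_PRQ_defect_packAC` — the two chains with top `P` together with the type-A defect
  pair `c1·c6` are packed by the AC goods `(c11 + c14)·c0`; this strictly contains gen 31's `s3P_weightTwo_pack`.
The two CYCLIC orientations admit no nine-type label certificate in any of the 2⁹ orientation patterns (exhaustive search, memo §2); they are
B_4-valid and their lattice status is open (SAT tests in the memo).  With the darts this exhausts nothing: the open content of R4 is the dart layer.
No sorries, no named facts, no new definitions; standard axioms.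
-/

namespace Summit.CriticalPhenomena.PercolationContinuityZ3.Theorems

namespace TwoCopyMono

open Finset FourPointAtoms

variable {n : ℕ}

/-- **Pairing chain `P > Q > R` is packed by the top good** (all `n`): with `P = ab|cy`, `Q = ac|by`, `R = ay|bc`, `e₂` of the three pairings plus each higher pairing times the two pairs of each lower pairing is at most `P(abcy)·P(a|b|c|y)`; in cells: `c9c11 + c8c11 + c8c9 + c5c11 + c2c11 + c4c11 + c3c11 + c4c9 + c3c9 ≤ c0c14` (nine-type label certificate, top goods). [this work] -/
theorem chain_PQR_pack (w : Sym2 (Fin n) → unitInterval) (a b c y : Fin n) :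
    cell w a b c y 11 * cell w a b c y 9 + cell w a b c y 11 * cell w a b c y 8 + cell w a b c y 9 * cell w a b c y 8 + cell w a b c y 11 * cell w a b c y 5 + cell w a b c y 11 * cell w a b c y 2 + cell w a b c y 11 * cell w a b c y 4 + cell w a b c y 11 * cell w a b c y 3 + cell w a b c y 9 * cell w a b c y 4 + cell w a b c y 9 * cell w a b c y 3 ≤
      cell w a b c y 14 * cell w a b c y 0 := by
  have h := packTop_of_tableOKT ({(11, 9), (11, 8), (9, 8), (11, 5), (11, 2), (11, 4), (11, 3), (9, 4), (9, 3)} : Finset (Fin 15 × Fin 15))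
    (fun p => if p = (11, 9) then 5 else if p = (11, 8) then 3 else if p = (9, 8) then 8 else if p = (11, 5) then 5 else if p = (11, 2) then 5 else if p = (11, 4) then 3 else if p = (11, 3) then 3 else if p = (9, 4) then 8 else 8)
    (by decide +kernel) w a b c y
  rw [Finset.sum_insert (by decide), Finset.sum_insert (by decide), Finset.sum_insert (by decide), Finset.sum_insert (by decide), Finset.sum_insert (by decide), Finset.sum_insert (by decide), Finset.sum_insert (by decide), Finset.sum_insert (by decide), Finset.sum_singleton] at h
  dsimp only at h
  linarith

/-- **Pairing chain `P > R > Q` is packed by the top good** (all `n`): with `P = ab|cy`, `R = ay|bc`, `Q = ac|by`, `e₂` of the three pairings plus each higher pairing times the two pairs of each lower pairing is at most `P(abcy)·P(a|b|c|y)`; in cells: `c9c11 + c8c11 + c8c9 + c4c11 + c3c11 + c5c11 + c2c11 + c5c8 + c2c8 ≤ c0c14` (nine-type label certificate, top goods). [this work] -/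
theorem chain_PRQ_pack (w : Sym2 (Fin n) → unitInterval) (a b c y : Fin n) :
    cell w a b c y 11 * cell w a b c y 9 + cell w a b c y 11 * cell w a b c y 8 + cell w a b c y 8 * cell w a b c y 9 + cell w a b c y 11 * cell w a b c y 4 + cell w a b c y 11 * cell w a b c y 3 + cell w a b c y 11 * cell w a b c y 5 + cell w a b c y 11 * cell w a b c y 2 + cell w a b c y 8 * cell w a b c y 5 + cell w a b c y 8 * cell w a b c y 2 ≤
      cell w a b c y 14 * cell w a b c y 0 := by
  have h := packTop_of_tableOKT ({(11, 9), (11, 8), (8, 9), (11, 4), (11, 3), (11, 5), (11, 2), (8, 5), (8, 2)} : Finset (Fin 15 × Fin 15))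
    (fun p => if p = (11, 9) then 1 else if p = (11, 8) then 7 else if p = (8, 9) then 8 else if p = (11, 4) then 7 else if p = (11, 3) then 7 else if p = (11, 5) then 1 else if p = (11, 2) then 1 else if p = (8, 5) then 8 else 8)
    (by decide +kernel) w a b c y
  rw [Finset.sum_insert (by decide), Finset.sum_insert (by decide), Finset.sum_insert (by decide), Finset.sum_insert (by decide), Finset.sum_insert (by decide), Finset.sum_insert (by decide), Finset.sum_insert (by decide), Finset.sum_insert (by decide), Finset.sum_singleton] at h
  dsimp only at h
  linarith

/-- **Pairing chain `Q > P > R` is packed by the top good** (all `n`): with `Q = ac|by`, `P = ab|cy`, `R = ay|bc`, `e₂` of the three pairings plus each higher pairing times the two pairs of each lower pairing is at most `P(abcy)·P(a|b|c|y)`; in cells: `c9c11 + c8c11 + c8c9 + c6c9 + c1c9 + c4c9 + c3c9 + c4c11 + c3c11 ≤ c0c14` (nine-type label certificate, top goods). [this work] -/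
theorem chain_QPR_pack (w : Sym2 (Fin n) → unitInterval) (a b c y : Fin n) :
    cell w a b c y 9 * cell w a b c y 11 + cell w a b c y 11 * cell w a b c y 8 + cell w a b c y 9 * cell w a b c y 8 + cell w a b c y 9 * cell w a b c y 6 + cell w a b c y 9 * cell w a b c y 1 + cell w a b c y 9 * cell w a b c y 4 + cell w a b c y 9 * cell w a b c y 3 + cell w a b c y 11 * cell w a b c y 4 + cell w a b c y 11 * cell w a b c y 3 ≤
      cell w a b c y 14 * cell w a b c y 0 := by
  have h := packTop_of_tableOKT ({(9, 11), (11, 8), (9, 8), (9, 6), (9, 1), (9, 4), (9, 3), (11, 4), (11, 3)} : Finset (Fin 15 × Fin 15))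
    (fun p => if p = (9, 11) then 5 else if p = (11, 8) then 8 else if p = (9, 8) then 3 else if p = (9, 6) then 5 else if p = (9, 1) then 5 else if p = (9, 4) then 3 else if p = (9, 3) then 3 else if p = (11, 4) then 8 else 8)
    (by decide +kernel) w a b c y
  rw [Finset.sum_insert (by decide), Finset.sum_insert (by decide), Finset.sum_insert (by decide), Finset.sum_insert (by decide), Finset.sum_insert (by decide), Finset.sum_insert (by decide), Finset.sum_insert (by decide), Finset.sum_insert (by decide), Finset.sum_singleton] at h
  dsimp only at h
  linarith

/-- **Pairing chain `Q > R > P` is packed by the top good** (all `n`): with `Q = ac|by`, `R = ay|bc`, `P = ab|cy`, `e₂` of the three pairings plus each higher pairing times the two pairs of each lower pairing is at most `P(abcy)·P(a|b|c|y)`; in cells: `c9c11 + c8c11 + c8c9 + c4c9 + c3c9 + c6c9 + c1c9 + c6c8 + c1c8 ≤ c0c14` (nine-type label certificate, top goods). [this work] -/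
theorem chain_QRP_pack (w : Sym2 (Fin n) → unitInterval) (a b c y : Fin n) :
    cell w a b c y 9 * cell w a b c y 11 + cell w a b c y 8 * cell w a b c y 11 + cell w a b c y 9 * cell w a b c y 8 + cell w a b c y 9 * cell w a b c y 4 + cell w a b c y 9 * cell w a b c y 3 + cell w a b c y 9 * cell w a b c y 6 + cell w a b c y 9 * cell w a b c y 1 + cell w a b c y 8 * cell w a b c y 6 + cell w a b c y 8 * cell w a b c y 1 ≤
      cell w a b c y 14 * cell w a b c y 0 := by
  have h := packTop_of_tableOKT ({(9, 11), (8, 11), (9, 8), (9, 4), (9, 3), (9, 6), (9, 1), (8, 6), (8, 1)} : Finset (Fin 15 × Fin 15))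
    (fun p => if p = (9, 11) then 1 else if p = (8, 11) then 7 else if p = (9, 8) then 8 else if p = (9, 4) then 8 else if p = (9, 3) then 8 else if p = (9, 6) then 1 else if p = (9, 1) then 1 else if p = (8, 6) then 7 else 7)
    (by decide +kernel) w a b c y
  rw [Finset.sum_insert (by decide), Finset.sum_insert (by decide), Finset.sum_insert (by decide), Finset.sum_insert (by decide), Finset.sum_insert (by decide), Finset.sum_insert (by decide), Finset.sum_insert (by decide), Finset.sum_insert (by decide), Finset.sum_singleton] at h
  dsimp only at h
  linarith

/-- **Pairing chain `R > P > Q` is packed by the top good** (all `n`): with `R = ay|bc`, `P = ab|cy`, `Q = ac|by`, `e₂` of the three pairings plus each higher pairing times the two pairs of each lower pairing is at most `P(abcy)·P(a|b|c|y)`; in cells: `c9c11 + c8c11 + c8c9 + c6c8 + c1c8 + c5c8 + c2c8 + c5c11 + c2c11 ≤ c0c14` (nine-type label certificate, top goods). [this work] -/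
theorem chain_RPQ_pack (w : Sym2 (Fin n) → unitInterval) (a b c y : Fin n) :
    cell w a b c y 11 * cell w a b c y 9 + cell w a b c y 8 * cell w a b c y 11 + cell w a b c y 8 * cell w a b c y 9 + cell w a b c y 8 * cell w a b c y 6 + cell w a b c y 8 * cell w a b c y 1 + cell w a b c y 8 * cell w a b c y 5 + cell w a b c y 8 * cell w a b c y 2 + cell w a b c y 11 * cell w a b c y 5 + cell w a b c y 11 * cell w a b c y 2 ≤
      cell w a b c y 14 * cell w a b c y 0 := by
  have h := packTop_of_tableOKT ({(11, 9), (8, 11), (8, 9), (8, 6), (8, 1), (8, 5), (8, 2), (11, 5), (11, 2)} : Finset (Fin 15 × Fin 15))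
    (fun p => if p = (11, 9) then 5 else if p = (8, 11) then 8 else if p = (8, 9) then 3 else if p = (8, 6) then 8 else if p = (8, 1) then 8 else if p = (8, 5) then 3 else if p = (8, 2) then 3 else if p = (11, 5) then 5 else 5)
    (by decide +kernel) w a b c y
  rw [Finset.sum_insert (by decide), Finset.sum_insert (by decide), Finset.sum_insert (by decide), Finset.sum_insert (by decide), Finset.sum_insert (by decide), Finset.sum_insert (by decide), Finset.sum_insert (by decide), Finset.sum_insert (by decide), Finset.sum_singleton] at h
  dsimp only at h
  linarith

/-- **Pairing chain `R > Q > P` is packed by the top good** (all `n`): with `R = ay|bc`, `Q = ac|by`, `P = ab|cy`, `e₂` of the three pairings plus each higher pairing times the two pairs of each lower pairing is at most `P(abcy)·P(a|b|c|y)`; in cells: `c9c11 + c8c11 + c8c9 + c5c8 + c2c8 + c6c8 + c1c8 + c6c9 + c1c9 ≤ c0c14` (nine-type label certificate, top goods). [this work] -/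
theorem chain_RQP_pack (w : Sym2 (Fin n) → unitInterval) (a b c y : Fin n) :
    cell w a b c y 9 * cell w a b c y 11 + cell w a b c y 8 * cell w a b c y 11 + cell w a b c y 8 * cell w a b c y 9 + cell w a b c y 8 * cell w a b c y 5 + cell w a b c y 8 * cell w a b c y 2 + cell w a b c y 8 * cell w a b c y 6 + cell w a b c y 8 * cell w a b c y 1 + cell w a b c y 9 * cell w a b c y 6 + cell w a b c y 9 * cell w a b c y 1 ≤
      cell w a b c y 14 * cell w a b c y 0 := by
  have h := packTop_of_tableOKT ({(9, 11), (8, 11), (8, 9), (8, 5), (8, 2), (8, 6), (8, 1), (9, 6), (9, 1)} : Finset (Fin 15 × Fin 15))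
    (fun p => if p = (9, 11) then 5 else if p = (8, 11) then 3 else if p = (8, 9) then 8 else if p = (8, 5) then 8 else if p = (8, 2) then 8 else if p = (8, 6) then 3 else if p = (8, 1) then 3 else if p = (9, 6) then 5 else 5)
    (by decide +kernel) w a b c y
  rw [Finset.sum_insert (by decide), Finset.sum_insert (by decide), Finset.sum_insert (by decide), Finset.sum_insert (by decide), Finset.sum_insert (by decide), Finset.sum_insert (by decide), Finset.sum_insert (by decide), Finset.sum_insert (by decide), Finset.sum_singleton] at h
  dsimp only at h
  linarith

/-- **Pairing chain `P > Q > R` plus the type-A defect pair `(ab|c|y ; a|b|cy)` is packed by the AC goods** (all `n`): `c9c11 + c8c11 + c8c9 + c5c11 + c2c11 + c4c11 + c3c11 + c4c9 + c3c9 + c1c6 ≤ (c11 + c14)·c0` (nine-type label certificate, goods `ab|cy, abcy`). Strengthens `s3P_weightTwo_pack` (the weight-two part of `S3′ = Θ(P,P)`) by the two products of `ac|by` with the pairs of `ay|bc`. [this work] -/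
theorem chain_PQR_defect_packAC (w : Sym2 (Fin n) → unitInterval) (a b c y : Fin n) :
    cell w a b c y 9 * cell w a b c y 11 + cell w a b c y 11 * cell w a b c y 8 + cell w a b c y 9 * cell w a b c y 8 + cell w a b c y 5 * cell w a b c y 11 + cell w a b c y 2 * cell w a b c y 11 + cell w a b c y 11 * cell w a b c y 4 + cell w a b c y 11 * cell w a b c y 3 + cell w a b c y 9 * cell w a b c y 4 + cell w a b c y 9 * cell w a b c y 3 + cell w a b c y 6 * cell w a b c y 1 ≤
      (cell w a b c y 11 + cell w a b c y 14) * cell w a b c y 0 := by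
  have h := pack_of_tableOK ({(9, 11), (11, 8), (9, 8), (5, 11), (2, 11), (11, 4), (11, 3), (9, 4), (9, 3), (6, 1)} : Finset (Fin 15 × Fin 15))
    (fun p => if p = (9, 11) then 6 else if p = (11, 8) then 8 else if p = (9, 8) then 8 else if p = (5, 11) then 6 else if p = (2, 11) then 6 else if p = (11, 4) then 8 else if p = (11, 3) then 8 else if p = (9, 4) then 8 else if p = (9, 3) then 8 else 1)
    (by decide +kernel) w a b c y
  rw [Finset.sum_insert (by decide), Finset.sum_insert (by decide), Finset.sum_insert (by decide), Finset.sum_insert (by decide), Finset.sum_insert (by decide), Finset.sum_insert (by decide), Finset.sum_insert (by decide), Finset.sum_insert (by decide), Finset.sum_insert (by decide), Finset.sum_singleton] at h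
  dsimp only at h
  linarith

/-- **Pairing chain `P > R > Q` plus the type-A defect pair `(ab|c|y ; a|b|cy)` is packed by the AC goods** (all `n`): `c9c11 + c8c11 + c8c9 + c4c11 + c3c11 + c5c11 + c2c11 + c5c8 + c2c8 + c1c6 ≤ (c11 + c14)·c0` (nine-type label certificate, goods `ab|cy, abcy`). Strengthens `s3P_weightTwo_pack` (the weight-two part of `S3′ = Θ(P,P)`) by the two products of `ay|bc` with the pairs of `ac|by`. [this work] -/
theorem chain_PRQ_defect_packAC (w : Sym2 (Fin n) → unitInterval) (a b c y : Fin n) :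
    cell w a b c y 11 * cell w a b c y 9 + cell w a b c y 8 * cell w a b c y 11 + cell w a b c y 8 * cell w a b c y 9 + cell w a b c y 4 * cell w a b c y 11 + cell w a b c y 3 * cell w a b c y 11 + cell w a b c y 11 * cell w a b c y 5 + cell w a b c y 11 * cell w a b c y 2 + cell w a b c y 8 * cell w a b c y 5 + cell w a b c y 8 * cell w a b c y 2 + cell w a b c y 6 * cell w a b c y 1 ≤
      (cell w a b c y 11 + cell w a b c y 14) * cell w a b c y 0 := by
  have h := pack_of_tableOK ({(11, 9), (8, 11), (8, 9), (4, 11), (3, 11), (11, 5), (11, 2), (8, 5), (8, 2), (6, 1)} : Finset (Fin 15 × Fin 15))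
    (fun p => if p = (11, 9) then 8 else if p = (8, 11) then 6 else if p = (8, 9) then 8 else if p = (4, 11) then 6 else if p = (3, 11) then 6 else if p = (11, 5) then 8 else if p = (11, 2) then 8 else if p = (8, 5) then 8 else if p = (8, 2) then 8 else 1)
    (by decide +kernel) w a b c y
  rw [Finset.sum_insert (by decide), Finset.sum_insert (by decide), Finset.sum_insert (by decide), Finset.sum_insert (by decide), Finset.sum_insert (by decide), Finset.sum_insert (by decide), Finset.sum_insert (by decide), Finset.sum_insert (by decide), Finset.sum_insert (by decide), Finset.sum_singleton] at h
  dsimp only at h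
  linarith

end TwoCopyMono

end Summit.CriticalPhenomena.PercolationContinuityZ3.Theorems
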